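import Summits.HodgeConjecture.CorCM.GaloisRightTranslateRank
import Summits.HodgeConjecture.CorCM.TwoSheetAnnihilator
import Summits.HodgeConjecture.CorCM.CyclicHalfOddCharacterSums
import Mathlib.GroupTheory.SpecificGroups.Quaternion
import HarnessLib

/-!
# Galois CM fields with DICYCLIC Galois group `Dic_n`, `n = 2^k q` (`q` an odd prime) or `n = 2^k`: every primitive
# CM type is nondegenerate — the Hodge conjecture for all powers of their simple CM abelian varieties

COR-CM (cell `pub-hodgecm2`), binder seat b04 (gen 20), count-neutral claim DICYCLIC-TWO-SHEET, part IV (the theorem;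
parts I–III: `CorCM/GaloisRightTranslateRank` — annihilator criterion on a model of the Galois group —,
`CorCM/TwoSheetAnnihilator` — Fourier analysis on an abelian subgroup of index two —,
`CorCM/CyclicHalfOddCharacterSums` — vanishing odd character sums on a cyclic group of order `2^{k+1} q` are
`q`-periodic).  KERNEL ONLY: theorems; no definition, no named fact, no `sorry`.  `HC_CM` is neither used nor claimed:
this is the Hodge conjecture for a NAMED CLASS of CM abelian varieties, UNCONDITIONALLY.

SETTING.  `Dic_n = ⟨a, x | a^{2n} = 1, x² = aⁿ, x a x⁻¹ = a⁻¹⟩` is Mathlib's `QuaternionGroup n` (order `4n`;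
`a i`, `xa i`); its UNIQUE involution `c = a n` is central, so a Galois CM field `K` with `Gal(K/ℚ) ≅ Dic_n` has
`[K:ℚ] = 4n`, complex conjugation `↦ a n` (`map_complexConj_eq_a`), and NO imaginary quadratic subfield (every
subgroup of even order contains `c`).  A CM type read on `Dic_n` is `S = a(S₁) ⊔ a(S₂)·x` with two CM halves
`S₁, S₂ ⊆ ℤ/2n` of the cyclic subgroup `⟨a⟩` (index `2`, `x u x⁻¹ = u⁻¹`, `x² = c`).  By parts I–II, `S` is
nondegenerate as soon as, for every ODD character `χ` of `ℤ/2n`,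
`Δ(χ) = Ŝ₁(χ) Ŝ₁(χ̄) − χ(c) Ŝ₂(χ) Ŝ₂(χ̄) = |Ŝ₁(χ)|² + |Ŝ₂(χ)|² ≠ 0`; and by part III (`n = 2^k q`) resp. gen 11
(`n = 2^k`) a vanishing `Ŝᵢ(χ)` makes the sheet `Sᵢ` periodic under `a^{2^{k+1}}` resp. is impossible.  Both sheets
periodic means `a^{2^{k+1}} S = S`: a LEFT STABILISER, i.e. `Φ` IMPRIMITIVE (gen 16 `not_isPrimitive_of_leftStabiliser`).

* §1 `eq_zero_of_annihilated_of_periodic` (the dicyclic two-sheet model on `Multiplicative (ZMod (2n)) →* Dic_n`),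
  `eq_zero_of_annihilated_dicyclic` (`n = 2^k q`, no left stabiliser `a^{2^{k+1}}`),
  `eq_zero_of_annihilated_quaternion` (`n = 2^k`, unconditionally).
* §2 `eq_a_of_mul_self_eq_one` (the unique involution of `Dic_n`), `map_complexConj_eq_a`, `finrank_eq_four_mul`.
* §3 **`isNondegenerate_of_isPrimitive_dicyclic`** — `Gal(K/ℚ) ≅ Dic_n`, `n = 2^k q`: EVERY PRIMITIVE CM TYPE OF `K`
  IS NONDEGENERATE (rank `2n + 1`); **`isNondegenerate_quaternion`** — `Gal(K/ℚ) ≅ Dic_{2^k} = Q_{2^{k+2}}`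
  (generalised quaternion `2`-groups `Q₈, Q₁₆, Q₃₂, …`): EVERY CM type is nondegenerate, hence primitive
  (`isPrimitive_quaternion`: such fields have no proper CM subfield).
* §4 **The Hodge conjecture for `A` and all powers `Aⁿ` of every SIMPLE abelian variety of dimension `2n` with complex
  multiplication by a Galois CM field with group `Dic_n`, `n = 2^k q` or `2^k`** (`hodgeConjectureFor_pow_of_isSimple_
  dicyclic`, `hodgeConjectureFor_pow_quaternion`), via Hazama–Gordon Thm. 6.4 (tree `IsNondegenerate.hodgeConjectureFor_
  pow`).  Uniform in `n`: `Q₈` (gen 13), `Dic₃` (gen 14), `Q₁₆` (gen 16), `Dic₅` (gen 19, census) were known in the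
  tree by other means; `Dic₆, Dic₇, Q₃₂, Dic₁₀, Dic₁₁, Dic₁₂, Dic₁₃, Dic₁₄, …` are new.  The hypothesis on `n` is sharp
  at the group level: `Dic₉` carries primitive degenerate CM types (seat census, corank `4`).

## References

* [Kubota1965] T. Kubota, Trans. AMS 118 (1965), §2 (rank; nondegenerate ⟹ primitive), §4 Lemma 2.
* [Dodson1984] B. Dodson, *The structure of Galois groups of CM-fields*, Trans. AMS 283 (1984), §3.1, §5 (group tables).
* [Shimura1998] G. Shimura, *Abelian Varieties with Complex Multiplication and Modular Functions*, §8.2 Prop. 26.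
* [Gordon1999HodgeAVSurvey] B. B. Gordon, *A survey of the Hodge conjecture for abelian varieties*, Thm. 6.4, §9.4.
-/

noncomputable section

open CategoryTheory CategoryTheory.Limits NumberField
open scoped BigOperators

namespace Summit.HodgeConjecture.CorCM.GaloisDicyclic

open Literature.NumberTheory.ComplexMultiplication
open Literature.AlgebraicGeometry.Motives (AbelianVariety CMType)
open Literature.AlgebraicGeometry.HodgeTheory
open Literature.AlgebraicGeometry.ComplexMultiplication (IsCMTypeRealisation isSimple_iff_isPrimitive)
open Literature.AlgebraicGeometry.Pohlmann1968
open Summit.HodgeConjecture.CorCM.GaloisRank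
open Summit.HodgeConjecture.CorCM.CyclicTwoPower
open QuaternionGroup AddChar

/-! ## §1 The dicyclic two-sheet model -/

section Model

variable {n : ℕ} [NeZero n]

/-- `z z̄ + w w̄ = 0` forces `z = w = 0`. [folklore] -/
theorem eq_zero_of_mul_conj_add_mul_conj_eq_zero {z w : ℂ} (h : z * starRingEnd ℂ z + w * starRingEnd ℂ w = 0) :
    z = 0 ∧ w = 0 := by
  rw [Complex.mul_conj, Complex.mul_conj, ← Complex.ofReal_add, Complex.ofReal_eq_zero] at h
  have hz := Complex.normSq_nonneg z
  have hw := Complex.normSq_nonneg w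
  exact ⟨Complex.normSq_eq_zero.1 (by linarith), Complex.normSq_eq_zero.1 (by linarith)⟩

/-- `ℤ/2n` (multiplicatively) is generated by `1`. [folklore] -/
theorem mem_powers_ofAdd_one (u : Multiplicative (ZMod (2 * n))) :
    u ∈ Submonoid.powers (Multiplicative.ofAdd (1 : ZMod (2 * n))) :=
  (Submonoid.mem_powers_iff _ _).2 ⟨(Multiplicative.toAdd u).val, by
    rw [← ofAdd_nsmul, Nat.smul_one_eq_cast, ZMod.natCast_zmod_val]; rfl⟩

omit [NeZero n] in
/-- `ofAdd 1` has order `2n` in `Multiplicative (ℤ/2n)`. [folklore] -/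
theorem orderOf_ofAdd_one : orderOf (Multiplicative.ofAdd (1 : ZMod (2 * n))) = 2 * n := by
  rw [orderOf_ofAdd_eq_addOrderOf, ZMod.addOrderOf_one]

/-- **The dicyclic two-sheet model.**  `S ⊆ Dic_n` a CM set (`a n · y ∈ S ↔ y ∉ S`), `p ∈ ℤ/2n` such that every CM
half `T ⊆ ℤ/2n` (for `n ∈ ℤ/2n`) on which some ODD character vanishes is `p`-periodic; if `a p` is NOT a left
stabiliser of `S`, then every `a n`-antisymmetric `b : Dic_n → ℚ` annihilated by the right translates of `S` is zero.
(Two-sheet determinant `|Ŝ₁(χ)|² + |Ŝ₂(χ)|²`: `θ = ⁻¹`, `x² = c`, `χ(c) = -1`.) [cite: Kubota1965, §4 Lemma 2] -/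
theorem eq_zero_of_annihilated_of_periodic (p : ZMod (2 * n))
    (hper : ∀ T : Finset (Multiplicative (ZMod (2 * n))),
      IsCMTypeWith (Multiplicative.ofAdd (n : ZMod (2 * n))) (↑T : Set (Multiplicative (ZMod (2 * n)))) →
      ∀ χ : AddChar (Additive (Multiplicative (ZMod (2 * n)))) ℂ,
        χ (Additive.ofMul (Multiplicative.ofAdd (n : ZMod (2 * n)))) = -1 →
        ∑ t ∈ T, χ (Additive.ofMul t) = 0 → ∀ u, u ∈ T ↔ u * Multiplicative.ofAdd p ∈ T)
    (S : Finset (QuaternionGroup n)) (hScm : ∀ y : QuaternionGroup n, a n * y ∈ S ↔ y ∉ S)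
    (hstab : ¬ ∀ w : QuaternionGroup n, w ∈ S ↔ a p * w ∈ S)
    (b : QuaternionGroup n → ℚ) (hb : ∀ g, b (a n * g) = -b g) (hann : ∀ g, ∑ s ∈ S, b (s * g) = 0) :
    b = 0 := by
  classical
  -- the cyclic subgroup `⟨a⟩ ≅ ℤ/2n`
  let i : Multiplicative (ZMod (2 * n)) →* QuaternionGroup n :=
    MonoidHom.mk' (fun u => a (Multiplicative.toAdd u)) fun u v => by simp [toAdd_mul]
  have hi_apply : ∀ u, i u = a (Multiplicative.toAdd u) := fun u => rfl
  have hi : Function.Injective i := fun u v h => by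
    have h' : a (Multiplicative.toAdd u) = a (Multiplicative.toAdd v) := h
    simpa using h'
  -- the second sheet `⟨a⟩ · x`, `x = xa 0`
  have hx : ∀ u, i u ≠ xa 0 := fun u => by simp [hi_apply]
  have hcov : ∀ g : QuaternionGroup n, (∃ u, g = i u) ∨ (∃ u, g = i u * xa 0) := by
    rintro (j | j)
    · exact Or.inl ⟨Multiplicative.ofAdd j, by simp [hi_apply]⟩
    · exact Or.inr ⟨Multiplicative.ofAdd (-j), by simp [hi_apply]⟩
  -- conjugation by `x` inverts `⟨a⟩`; `x² = c = a n`
  let θ : Multiplicative (ZMod (2 * n)) ≃* Multiplicative (ZMod (2 * n)) := MulEquiv.inv _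
  have hθ_apply : ∀ u, θ u = u⁻¹ := fun u => rfl
  have hθ : ∀ u, xa (0 : ZMod (2 * n)) * i u = i (θ u) * xa 0 := fun u => by
    simp [hi_apply, hθ_apply]
  set c : Multiplicative (ZMod (2 * n)) := Multiplicative.ofAdd (n : ZMod (2 * n)) with hc_def
  have hic : i c = a n := rfl
  have hxx : xa (0 : ZMod (2 * n)) * xa 0 = i c := by simp [hic]
  have hnn : (n : ZMod (2 * n)) + n = 0 := by
    rw [← two_mul]
    exact_mod_cast ZMod.natCast_self (2 * n)
  have hcc : c * c = 1 := by
    change Multiplicative.ofAdd ((n : ZMod (2 * n)) + n) = Multiplicative.ofAdd 0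
    rw [hnn]
  have hθc : θ c = c := by
    rw [hθ_apply]
    change Multiplicative.ofAdd (-(n : ZMod (2 * n))) = Multiplicative.ofAdd (n : ZMod (2 * n))
    rw [neg_eq_of_add_eq_zero_left hnn]
  -- the two sheets of `S`
  set S₁ : Finset (Multiplicative (ZMod (2 * n))) := Finset.univ.filter fun u => i u ∈ S with hS₁_def
  set S₂ : Finset (Multiplicative (ZMod (2 * n))) := Finset.univ.filter fun u => i u * xa 0 ∈ S with hS₂_def
  have hS₁ : ∀ u, u ∈ S₁ ↔ i u ∈ S := fun u => by simp [hS₁_def]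
  have hS₂ : ∀ u, u ∈ S₂ ↔ i u * xa 0 ∈ S := fun u => by simp [hS₂_def]
  have hS₁cm : IsCMTypeWith c (↑S₁ : Set (Multiplicative (ZMod (2 * n)))) := by
    refine ⟨fun u => ?_, fun g u => ?_, fun u => ?_⟩
    · rw [Finset.mem_coe, Finset.mem_coe, hS₁, hS₁, smul_eq_mul, map_mul, hic, hScm, not_not]
    · simp only [smul_eq_mul, mul_left_comm]
    · rw [smul_eq_mul, smul_eq_mul, ← mul_assoc, hcc, one_mul]
  have hS₂cm : IsCMTypeWith c (↑S₂ : Set (Multiplicative (ZMod (2 * n)))) := by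
    refine ⟨fun u => ?_, fun g u => ?_, fun u => ?_⟩
    · rw [Finset.mem_coe, Finset.mem_coe, hS₂, hS₂, smul_eq_mul, map_mul, hic, mul_assoc, hScm, not_not]
    · simp only [smul_eq_mul, mul_left_comm]
    · rw [smul_eq_mul, smul_eq_mul, ← mul_assoc, hcc, one_mul]
  -- `a p · i(u) = i(u · p)`
  have hpu : ∀ u, a p * i u = i (u * Multiplicative.ofAdd p) := fun u => by
    simp [hi_apply, add_comm]
  -- the determinant `|Ŝ₁|² + |Ŝ₂|²` does not vanish on odd characters
  have hdet : ∀ χ : AddChar (Additive (Multiplicative (ZMod (2 * n)))) ℂ, χ (Additive.ofMul c) = -1 →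
      (∑ s ∈ S₁, χ (Additive.ofMul s)) * (∑ s ∈ S₁, χ (Additive.ofMul (θ s))) -
        χ (Additive.ofMul c) * ((∑ t ∈ S₂, χ (Additive.ofMul t)) * (∑ t ∈ S₂, χ (Additive.ofMul (θ t)))) ≠ 0 := by
    intro χ hχ hΔ
    have hconj : ∀ u, χ (Additive.ofMul (θ u)) = starRingEnd ℂ (χ (Additive.ofMul u)) := fun u => by
      rw [hθ_apply, ofMul_inv, AddChar.map_neg_eq_conj]
    simp_rw [hconj] at hΔ
    rw [← map_sum (starRingEnd ℂ), ← map_sum (starRingEnd ℂ), hχ] at hΔ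
    obtain ⟨h1, h2⟩ := eq_zero_of_mul_conj_add_mul_conj_eq_zero (z := ∑ s ∈ S₁, χ (Additive.ofMul s))
      (w := ∑ t ∈ S₂, χ (Additive.ofMul t)) (by linear_combination hΔ)
    have hp1 := hper S₁ hS₁cm χ hχ h1
    have hp2 := hper S₂ hS₂cm χ hχ h2
    apply hstab
    intro w
    rcases hcov w with ⟨u, rfl⟩ | ⟨u, rfl⟩
    · rw [← hS₁, hp1 u, hS₁, hpu]
    · rw [← hS₂, hp2 u, hS₂, ← mul_assoc, hpu]
  exact TwoSheet.eq_zero_of_twoSheet i hi (xa 0) hx hcov θ hθ c hxx hcc hθc S S₁ S₂ hS₁ hS₂ hdet b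
    (fun g => by rw [hic]; exact hb g) hann

/-- **`Dic_n`, `n = 2^k q` (`q` an odd prime): if `a^{2^{k+1}}` is not a left stabiliser of the CM set `S`, every
`a n`-antisymmetric weight annihilated by the right translates of `S` vanishes.** [cite: Kubota1965, §4 Lemma 2] -/
theorem eq_zero_of_annihilated_dicyclic {k q : ℕ} (hn : n = 2 ^ k * q) (hq : q.Prime) (hq2 : q ≠ 2)
    (S : Finset (QuaternionGroup n)) (hScm : ∀ y : QuaternionGroup n, a n * y ∈ S ↔ y ∉ S)
    (hstab : ¬ ∀ w : QuaternionGroup n, w ∈ S ↔ a ((2 ^ (k + 1) : ℕ) : ZMod (2 * n)) * w ∈ S)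
    (b : QuaternionGroup n → ℚ) (hb : ∀ g, b (a n * g) = -b g) (hann : ∀ g, ∑ s ∈ S, b (s * g) = 0) :
    b = 0 := by
  have hγ : orderOf (Multiplicative.ofAdd (1 : ZMod (2 * n))) = 2 ^ (k + 1) * q := by
    rw [orderOf_ofAdd_one, hn]; ring
  refine eq_zero_of_annihilated_of_periodic _ (fun T hT χ hχ h0 u => ?_) S hScm hstab b hb hann
  have h := mul_pow_mem_iff_of_sum_eq_zero hq hq2 hγ mem_powers_ofAdd_one hT χ hχ h0 u
  rwa [← ofAdd_nsmul, Nat.smul_one_eq_cast] at h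

/-- **`Dic_n`, `n = 2^k` (generalised quaternion `2`-groups `Q_{2^{k+2}}`): every `a n`-antisymmetric weight
annihilated by the right translates of a CM set vanishes** — no odd character of `ℤ/2^{k+1}` vanishes on a CM half
(gen 11 `sum_ne_zero_of_orderOf_eq_two_pow`). [cite: Kubota1965, §4 Lemma 2] -/
theorem eq_zero_of_annihilated_quaternion {k : ℕ} (hn : n = 2 ^ k)
    (S : Finset (QuaternionGroup n)) (hScm : ∀ y : QuaternionGroup n, a n * y ∈ S ↔ y ∉ S)
    (b : QuaternionGroup n → ℚ) (hb : ∀ g, b (a n * g) = -b g) (hann : ∀ g, ∑ s ∈ S, b (s * g) = 0) :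
    b = 0 := by
  have hγ : orderOf (Multiplicative.ofAdd (1 : ZMod (2 * n))) = 2 ^ (k + 1) := by
    rw [orderOf_ofAdd_one, hn, pow_succ, mul_comm]
  refine eq_zero_of_annihilated_of_periodic (n : ZMod (2 * n))
    (fun T hT χ hχ h0 _ => absurd h0 (sum_ne_zero_of_orderOf_eq_two_pow hγ mem_powers_ofAdd_one hT χ hχ))
    S hScm (fun h => ?_) b hb hann
  have h1 := h 1
  rw [hScm] at h1
  exact iff_not_self h1

end Model

/-! ## §2 The involution of `Dic_n` and complex conjugation -/

section Involution

variable {n : ℕ} [NeZero n]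

/-- **`a n` is the unique involution of `Dic_n`** (`(xa i)² = a n ≠ 1`; `(a j)² = 1` iff `2j = 0` iff `j ∈ {0, n}`).
[cite: Dodson1984, §5 (group tables)] -/
theorem eq_a_of_mul_self_eq_one (y : QuaternionGroup n) (hy : y * y = 1) (hy1 : y ≠ 1) : y = a n := by
  have hn0 : (n : ZMod (2 * n)) ≠ 0 := by
    rw [Ne, ZMod.natCast_eq_zero_iff]
    intro h
    have := Nat.le_of_dvd (NeZero.pos n) h
    have := NeZero.pos n
    omega
  rcases y with j | j
  · -- `2j = 0`
    have h2 : j + j = 0 := by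
      have : a (j + j) = (a 0 : QuaternionGroup n) := by rw [← a_mul_a, hy, one_def]
      exact a.inj this
    have hdvd : 2 * n ∣ j.val + j.val := by
      rw [← ZMod.natCast_eq_zero_iff, Nat.cast_add, ZMod.natCast_zmod_val, h2]
    have hlt := j.val_lt
    obtain ⟨t, ht⟩ : n ∣ j.val := Nat.dvd_of_mul_dvd_mul_left (by norm_num : 0 < 2) (by rw [two_mul j.val]; exact hdvd)
    have ht2 : t < 2 := by
      by_contra h; push Not at h
      have : 2 * n ≤ j.val := by rw [ht]; nlinarith
      omega
    interval_cases t
    · exfalso; apply hy1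
      rw [mul_zero] at ht
      rw [one_def, ← ZMod.natCast_zmod_val j, ht, Nat.cast_zero]
    · rw [mul_one] at ht
      rw [← ZMod.natCast_zmod_val j, ht]
  · exfalso
    apply hn0
    have : a ((n : ZMod (2 * n)) + j - j) = (a 0 : QuaternionGroup n) := by rw [← xa_mul_xa, hy, one_def]
    simpa using a.inj this

variable {K : Type} [Field K] [NumberField K] [IsCMField K]

/-- Complex conjugation maps to `a n` under any isomorphism `Gal(K/ℚ) ≃ Dic_n`. [folklore] -/
theorem map_complexConj_eq_a (e : (K ≃ₐ[ℚ] K) ≃* QuaternionGroup n) :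
    e ((IsCMField.complexConj K).restrictScalars ℚ) = a n :=
  eq_a_of_mul_self_eq_one _ (model_complexConj_mul_self e rfl) (model_complexConj_ne_one e rfl)

omit [IsCMField K] in
/-- `[K:ℚ] = 4n`. [folklore] -/
theorem finrank_eq_four_mul [IsGalois ℚ K] (e : (K ≃ₐ[ℚ] K) ≃* QuaternionGroup n) :
    Module.finrank ℚ K = 4 * n := by
  rw [← card_model_eq_finrank e, QuaternionGroup.card]

end Involution

/-! ## §3 Nondegeneracy -/

section Field

variable {n : ℕ} [NeZero n]
variable {K : Type} [Field K] [NumberField K] [IsCMField K] [IsGalois ℚ K]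

/-- **THEOREM.  For a Galois CM field `K` with `Gal(K/ℚ) ≅ Dic_n`, `n = 2^k q` with `q` an odd prime, every
PRIMITIVE CM type is NONDEGENERATE** (Kubota rank `2n + 1`).  The obstruction `|Ŝ₁(χ)|² + |Ŝ₂(χ)|² = 0` would make
`a^{2^{k+1}} ≠ 1` a left stabiliser of the type read on `Dic_n`, contradicting primitivity (Shimura §8.2 Prop. 26).
[cite: Kubota1965, §4 Lemma 2] [cite: Shimura1998, §8.2 Prop. 26] -/
theorem isNondegenerate_of_isPrimitive_dicyclic {k q : ℕ} (hn : n = 2 ^ k * q) (hq : q.Prime) (hq2 : q ≠ 2)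
    (e : (K ≃ₐ[ℚ] K) ≃* QuaternionGroup n) {Φ : CMType K} (φ₀ : K →+* ℂ)
    (hprim : IsPrimitive (ℂ ≃+* ℂ) Φ.1 φ₀) : IsNondegenerate Φ := by
  classical
  have hc := map_complexConj_eq_a e
  set S : Finset (QuaternionGroup n) := Finset.univ.filter fun y => embOf φ₀ (e.symm y) ∈ Φ.1 with hS_def
  have hS : ∀ y, y ∈ S ↔ embOf φ₀ (e.symm y) ∈ Φ.1 := fun y => by
    simp only [hS_def, Finset.mem_filter, Finset.mem_univ, true_and]
  have hScm := model_mul_mem_iff e hc Φ φ₀ S hS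
  -- `a^{2^{k+1}} ≠ 1` is not a left stabiliser (primitivity)
  have hv1 : (a ((2 ^ (k + 1) : ℕ) : ZMod (2 * n)) : QuaternionGroup n) ≠ 1 := by
    rw [one_def, Ne, a.injEq, ZMod.natCast_eq_zero_iff]
    intro h
    have h1 := Nat.le_of_dvd (by positivity) h
    have h2 : 2 * n = 2 ^ (k + 1) * q := by rw [hn]; ring
    have h3 := hq.two_le
    have h4 : 0 < 2 ^ (k + 1) := by positivity
    nlinarith
  have hstab : ¬ ∀ w : QuaternionGroup n, w ∈ S ↔ a ((2 ^ (k + 1) : ℕ) : ZMod (2 * n)) * w ∈ S :=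
    fun h => not_isPrimitive_of_leftStabiliser e Φ φ₀ S hS hv1 h hprim
  exact (isNondegenerate_iff_forall_annihilator e hc Φ φ₀ S hS).2 fun b hb hann =>
    eq_zero_of_annihilated_dicyclic hn hq hq2 S hScm hstab b hb hann

/-- The rank: `cmTypeRank Φ = 2n + 1`. [cite: Kubota1965, §2 (p. 115)] -/
theorem cmTypeRank_eq_of_isPrimitive_dicyclic {k q : ℕ} (hn : n = 2 ^ k * q) (hq : q.Prime) (hq2 : q ≠ 2)
    (e : (K ≃ₐ[ℚ] K) ≃* QuaternionGroup n) {Φ : CMType K} (φ₀ : K →+* ℂ)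
    (hprim : IsPrimitive (ℂ ≃+* ℂ) Φ.1 φ₀) : cmTypeRank Φ = 2 * n + 1 := by
  have h := isNondegenerate_of_isPrimitive_dicyclic hn hq hq2 e φ₀ hprim
  rw [isNondegenerate_iff, finrank_eq_four_mul e] at h
  rw [h]; omega

/-- **THEOREM.  For a Galois CM field `K` with generalised quaternion Galois group `Q_{2^{k+2}} = Dic_{2^k}`
(`Q₈, Q₁₆, Q₃₂, …`), EVERY CM type is NONDEGENERATE** — no primitivity hypothesis: such a field has no proper CM
subfield. [cite: Kubota1965, §4 Lemma 2] -/
theorem isNondegenerate_quaternion {k : ℕ} (hn : n = 2 ^ k) (e : (K ≃ₐ[ℚ] K) ≃* QuaternionGroup n)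
    (Φ : CMType K) : IsNondegenerate Φ := by
  classical
  obtain ⟨φ₀⟩ := (inferInstance : Nonempty (K →+* ℂ))
  have hc := map_complexConj_eq_a e
  set S : Finset (QuaternionGroup n) := Finset.univ.filter fun y => embOf φ₀ (e.symm y) ∈ Φ.1 with hS_def
  have hS : ∀ y, y ∈ S ↔ embOf φ₀ (e.symm y) ∈ Φ.1 := fun y => by
    simp only [hS_def, Finset.mem_filter, Finset.mem_univ, true_and]
  have hScm := model_mul_mem_iff e hc Φ φ₀ S hS
  exact (isNondegenerate_iff_forall_annihilator e hc Φ φ₀ S hS).2 fun b hb hann =>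
    eq_zero_of_annihilated_quaternion hn S hScm b hb hann

/-- Hence every CM type of such a field is PRIMITIVE (Kubota: nondegenerate ⟹ primitive). [cite: Kubota1965, §2 (p. 115)] -/
theorem isPrimitive_quaternion {k : ℕ} (hn : n = 2 ^ k) (e : (K ≃ₐ[ℚ] K) ≃* QuaternionGroup n)
    (Φ : CMType K) (φ₀ : K →+* ℂ) : IsPrimitive (ℂ ≃+* ℂ) Φ.1 φ₀ :=
  (isNondegenerate_quaternion hn e Φ).isPrimitive φ₀

end Field

/-! ## §4 The Hodge conjecture for the simple CM abelian varieties and their powers -/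

section Geometry

variable {n : ℕ} [NeZero n]
variable {K : Type} [Field K] [NumberField K] [IsCMField K] [IsGalois ℚ K]
variable {Φ : CMType K} {A : AbelianVariety ℂ} {ι : 𝓞 K →+* End A}
  {θ : K →+* Module.End ℂ (complexBetti A.X 1)}

/-- **THE HODGE CONJECTURE FOR EVERY POWER OF EVERY SIMPLE ABELIAN VARIETY (of dimension `2n`) WITH COMPLEX
MULTIPLICATION BY A GALOIS CM FIELD WITH DICYCLIC GALOIS GROUP `Dic_n`, `n = 2^k q`, `q` an odd prime** —
unconditionally. [cite: Gordon1999HodgeAVSurvey, Thm. 6.4] [cite: Shimura1998, §8.2 Prop. 26] -/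
theorem hodgeConjectureFor_pow_of_isSimple_dicyclic {k q : ℕ} (hn : n = 2 ^ k * q) (hq : q.Prime) (hq2 : q ≠ 2)
    (e : (K ≃ₐ[ℚ] K) ≃* QuaternionGroup n) (hA : IsCMTypeRealisation Φ A ι θ) (hs : A.IsSimple) (N : ℕ) :
    HodgeConjectureFor (⨁ fun _ : Fin N => A).dim (⨁ fun _ : Fin N => A).X := by
  obtain ⟨φ₀⟩ := (inferInstance : Nonempty (K →+* ℂ))
  exact (isNondegenerate_of_isPrimitive_dicyclic hn hq hq2 e φ₀
    ((isSimple_iff_isPrimitive hA φ₀).1 hs)).hodgeConjectureFor_pow hA N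

/-- The Hodge conjecture for the simple abelian variety itself. [cite: Gordon1999HodgeAVSurvey, Thm. 6.4] -/
theorem hodgeConjectureFor_of_isSimple_dicyclic {k q : ℕ} (hn : n = 2 ^ k * q) (hq : q.Prime) (hq2 : q ≠ 2)
    (e : (K ≃ₐ[ℚ] K) ≃* QuaternionGroup n) (hA : IsCMTypeRealisation Φ A ι θ) (hs : A.IsSimple) :
    HodgeConjectureFor A.dim A.X := by
  obtain ⟨φ₀⟩ := (inferInstance : Nonempty (K →+* ℂ))
  exact (isNondegenerate_of_isPrimitive_dicyclic hn hq hq2 e φ₀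
    ((isSimple_iff_isPrimitive hA φ₀).1 hs)).hodgeConjectureFor hA

/-- `Bᵐ(Aⁿ) ⊗ ℂ = Dᵐ(Aⁿ) ⊗ ℂ` on every power of such a simple abelian variety (White–Hazama).
[cite: Gordon1999HodgeAVSurvey, §9.3] -/
theorem hodgeClassSpan_pow_eq_divisorClassesSpan_of_isSimple_dicyclic {k q : ℕ} (hn : n = 2 ^ k * q)
    (hq : q.Prime) (hq2 : q ≠ 2) (e : (K ≃ₐ[ℚ] K) ≃* QuaternionGroup n) (hA : IsCMTypeRealisation Φ A ι θ)
    (hs : A.IsSimple) (N m : ℕ) :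
    Literature.AlgebraicGeometry.VanGeemen1994.hodgeClassSpan (⨁ fun _ : Fin N => A).dim (⨁ fun _ : Fin N => A).X m =
      Literature.Barriers.HodgeConjecture.divisorClassesSpan (⨁ fun _ : Fin N => A).X
        (⨁ fun _ : Fin N => A).dim m := by
  obtain ⟨φ₀⟩ := (inferInstance : Nonempty (K →+* ℂ))
  exact (isNondegenerate_of_isPrimitive_dicyclic hn hq hq2 e φ₀
    ((isSimple_iff_isPrimitive hA φ₀).1 hs)).hodgeClassSpan_pow_eq_divisorClassesSpan hA N m

/-- **Generalised quaternion Galois groups `Q_{2^{k+2}}`: every abelian variety with CM by `K` realising a CM type is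
SIMPLE (all types are primitive) and satisfies the Hodge conjecture together with all its powers.**
[cite: Gordon1999HodgeAVSurvey, Thm. 6.4] -/
theorem hodgeConjectureFor_pow_quaternion {k : ℕ} (hn : n = 2 ^ k) (e : (K ≃ₐ[ℚ] K) ≃* QuaternionGroup n)
    (hA : IsCMTypeRealisation Φ A ι θ) (N : ℕ) :
    HodgeConjectureFor (⨁ fun _ : Fin N => A).dim (⨁ fun _ : Fin N => A).X :=
  (isNondegenerate_quaternion hn e Φ).hodgeConjectureFor_pow hA N

/-- … and the abelian variety is simple of dimension `2n = 2^{k+1}`. [cite: Shimura1998, §8.2 Prop. 26] -/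
theorem isSimple_quaternion {k : ℕ} (hn : n = 2 ^ k) (e : (K ≃ₐ[ℚ] K) ≃* QuaternionGroup n)
    (hA : IsCMTypeRealisation Φ A ι θ) : A.IsSimple := by
  obtain ⟨φ₀⟩ := (inferInstance : Nonempty (K →+* ℂ))
  exact (isSimple_iff_isPrimitive hA φ₀).2 (isPrimitive_quaternion hn e Φ φ₀)

end Geometry

end Summit.HodgeConjecture.CorCM.GaloisDicyclic

end
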